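import Literature.NumberTheory.Irrationality.PAdicZetaValues.HurwitzVolkenbornProofs
import Literature.NumberTheory.Irrationality.PAdicZetaValues.TwoAdicBernoulliVolkenbornProofs
import HarnessLib

/-!
# Lai 2025, Lemma 2.7 (`p = 2`): `ζ_2(j) = ½ ζ_2(j, ¼)` — PROOF of the named fact `lai2025TwoAdic_lemma27_two`

L. Lai, *On the irrationality of certain 2-adic zeta values*, Int. J. Number Theory 21 (2025) =
arXiv:2304.00816 [Lai2025TwoAdicZeta], §2.3, **Lemma 2.7**: "In particular, for any odd integer `j ≥ 3`
we have `ζ_2(j) = ½ ζ_2(j, ¼)`. *Proof.* It follows directly from the definition and the reflection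
formula."  The source's definition is `ζ_p(s) := L_p(s, ω^{1−s})`; the TREE's `ζ_p(j)`
(`PAdicZetaValues/Basic.lean`, `padicZetaValue`) is the INTERPOLATION limit
`lim_N −(1 − 2^{m_N−1}) B_{m_N}/m_N`, `m_N = 2^{N+j} + 1 − j` ("the `p − 1` branches interpolating the
values of the Riemann zeta function at negative integers", §2.3), and `ζ_2(j, ¼)` is the Volkenborn form
of `Hurwitz.lean`; so this discharge PROVES the interpolation for the branch at hand:
* §1 (folklore, private): `1`-units — `‖1 + 4t‖ = 1`, `‖a^{2^M} − b^{2^M}‖ ≤ 2^{−M}‖a − b‖`,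
  `‖a^{−e} − b^{−e}‖ ≤ ‖a − b‖`;
* §2 `norm_volkenbornSum_pow_sub_zpow_le`: for `m + e = 2^M`, uniformly in `r`,
  `‖S_r((1+4t)^m) − S_r((1+4t)^{−e})‖ ≤ 2·2^{−M}` (the tree's `norm_volkenbornSum_le`, Robert V.5.1);
* §3 `tendsto_cast_zetaNeg_interpIndex_two`: the EXACT defining sequence of `padicZetaValue 2 j`
  (its `m_N`, its sign, its factor `1 − 2^{m_N−1}`) CONVERGES, to `W/(2(j−1))`,
  `W = lim_r S_r((1+4t)^{1−j}) = ∫_{ℤ_2} (1+4t)^{1−j} dt`, via `(1 − 2^{m−1})B_m = ½∫(1+4t)^m dt`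
  (`TwoAdicBernoulliVolkenbornProofs`) and `m_N → 1 − j`; hence `padicZetaValue 2 j = W/(2(j−1))`;
* §4 `ω(¼) = ¼`, `⟨¼ + m⟩ = 1 + 4m`, `ζ_2(j, ¼) = W/(j−1)`; §5 `lai2025TwoAdic_lemma27_two_holds`.

CONVENTIONS: `B_m` is Mathlib's `bernoulli` (`B₁ = −½`), the convention of `Basic.lean`'s `zetaNeg` AND
of the tree's `tendsto_volkenbornSum_pow` (Robert's `b_k`); only EVEN `m = m_N ≥ 2` occur here, so the
sign convention of `B₁` is irrelevant.  Theorems only; `Basic.lean` / `Hurwitz.lean` untouched.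
Cell pub-zeta5 (HONEST FRAMING: systematic search; no irrationality claim unless kernel-certified): a
`2`-adic interpolation lemma relating the tree's two typed `ζ_2`'s; nothing here bears on `ζ(5) ∈ ℝ`.
-/

noncomputable section

open Filter Finset
open scoped Topology

namespace Literature.NumberTheory.Irrationality.PAdicZetaValues

open Literature.NumberTheory.LocalFields

/-! ## §1. `1`-units of `ℚ_2` (folklore) -/

section UnitPowers

variable {p : ℕ} [hp : Fact p.Prime]

/-- `‖aⁿ − bⁿ‖ ≤ ‖a − b‖` for `‖a‖, ‖b‖ ≤ 1`. [folklore] -/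
private theorem norm_pow_sub_pow_le' {a b : ℚ_[p]} (ha : ‖a‖ ≤ 1) (hb : ‖b‖ ≤ 1) (n : ℕ) :
    ‖a ^ n - b ^ n‖ ≤ ‖a - b‖ := by
  rw [← geom_sum₂_mul, norm_mul]
  refine mul_le_of_le_one_left (norm_nonneg _) ?_
  refine IsUltrametricDist.norm_sum_le_of_forall_le_of_nonneg zero_le_one fun i _ => ?_
  rw [norm_mul, norm_pow, norm_pow]
  exact mul_le_one₀ (pow_le_one₀ (norm_nonneg _) ha) (pow_nonneg (norm_nonneg _) _)
    (pow_le_one₀ (norm_nonneg _) hb)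

/-- `‖a^{−e} − b^{−e}‖ ≤ ‖a − b‖` for units `a, b`. [folklore] -/
private theorem norm_zpow_neg_sub_zpow_neg_le {a b : ℚ_[p]} (ha : ‖a‖ = 1) (hb : ‖b‖ = 1) (e : ℕ) :
    ‖a ^ (-(e : ℤ)) - b ^ (-(e : ℤ))‖ ≤ ‖a - b‖ := by
  have ha0 : a ≠ 0 := norm_pos_iff.mp (by rw [ha]; exact one_pos)
  have hb0 : b ≠ 0 := norm_pos_iff.mp (by rw [hb]; exact one_pos)
  rw [zpow_neg, zpow_neg, zpow_natCast, zpow_natCast,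
    inv_sub_inv' (pow_ne_zero _ ha0) (pow_ne_zero _ hb0), norm_mul, norm_mul, norm_inv, norm_inv,
    norm_pow, norm_pow, ha, hb, one_pow, inv_one, one_mul, mul_one, norm_sub_rev]
  exact norm_pow_sub_pow_le' ha.le hb.le e

end UnitPowers

/-- `‖2‖_2 = ½`. [folklore] -/
private theorem norm_two : ‖(2 : ℚ_[2])‖ = 2⁻¹ := by
  simpa using Padic.norm_p (p := 2)

/-- `‖4‖_2 = ¼`. [folklore] -/
private theorem norm_four : ‖(4 : ℚ_[2])‖ = 4⁻¹ := by
  rw [show (4 : ℚ_[2]) = 2 ^ 2 by norm_num, norm_pow, norm_two]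
  norm_num

/-- `4 ≠ 0` in `ℚ_2`. [folklore] -/
private theorem four_ne_zero' : (4 : ℚ_[2]) ≠ 0 := by
  rw [← norm_pos_iff, norm_four]
  norm_num

/-- The squaring step at `p = 2`: `‖a² − b²‖ ≤ ½‖a − b‖` for `‖a‖, ‖b‖ ≤ 1`, `‖a − b‖ ≤ ½`
(`a + b = 2b + (a − b)`). [folklore] -/
private theorem norm_sq_sub_sq_le {a b : ℚ_[2]} (hb : ‖b‖ ≤ 1) (hab : ‖a - b‖ ≤ 2⁻¹) :
    ‖a ^ 2 - b ^ 2‖ ≤ 2⁻¹ * ‖a - b‖ := by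
  rw [show a ^ 2 - b ^ 2 = (a + b) * (a - b) by ring, norm_mul]
  refine mul_le_mul_of_nonneg_right ?_ (norm_nonneg _)
  rw [show a + b = 2 * b + (a - b) by ring]
  refine (IsUltrametricDist.norm_add_le_max _ _).trans (max_le ?_ hab)
  rw [norm_mul, norm_two]
  exact mul_le_of_le_one_right (by norm_num) hb

/-- `‖a^{2^M} − b^{2^M}‖ ≤ 2^{−M}‖a − b‖` for `‖a‖, ‖b‖ ≤ 1` with `‖a − b‖ ≤ ½`. [folklore] -/
private theorem norm_pow_two_pow_sub_le {a b : ℚ_[2]} (hb : ‖b‖ ≤ 1)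
    (hab : ‖a - b‖ ≤ 2⁻¹) (M : ℕ) :
    ‖a ^ 2 ^ M - b ^ 2 ^ M‖ ≤ (2⁻¹ : ℝ) ^ M * ‖a - b‖ := by
  induction M with
  | zero => simp
  | succ M ih =>
    have hb' : ‖b ^ 2 ^ M‖ ≤ 1 := by rw [norm_pow]; exact pow_le_one₀ (norm_nonneg _) hb
    have hab' : ‖a ^ 2 ^ M - b ^ 2 ^ M‖ ≤ 2⁻¹ := by
      refine ih.trans ?_
      calc (2⁻¹ : ℝ) ^ M * ‖a - b‖ ≤ 1 * 2⁻¹ :=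
            mul_le_mul (pow_le_one₀ (by norm_num) (by norm_num)) hab (norm_nonneg _) zero_le_one
        _ = 2⁻¹ := one_mul _
    have h := norm_sq_sub_sq_le hb' hab'
    rw [← pow_mul, ← pow_mul, ← pow_succ] at h
    calc ‖a ^ 2 ^ (M + 1) - b ^ 2 ^ (M + 1)‖ ≤ 2⁻¹ * ‖a ^ 2 ^ M - b ^ 2 ^ M‖ := h
      _ ≤ 2⁻¹ * ((2⁻¹ : ℝ) ^ M * ‖a - b‖) := by gcongr
      _ = (2⁻¹ : ℝ) ^ (M + 1) * ‖a - b‖ := by ring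

/-- `‖1 + 4t‖_2 = 1` for `t ∈ ℤ_2`. [folklore] -/
private theorem norm_one_add_four_mul (t : ℤ_[2]) : ‖(1 : ℚ_[2]) + 4 * (t : ℚ_[2])‖ = 1 := by
  have h : ‖(4 : ℚ_[2]) * (t : ℚ_[2])‖ < ‖(1 : ℚ_[2])‖ := by
    rw [norm_mul, norm_four, norm_one]
    calc 4⁻¹ * ‖(t : ℚ_[2])‖ ≤ 4⁻¹ * 1 := by
          gcongr
          exact PadicInt.norm_le_one t
      _ < 1 := by norm_num
  rw [Padic.add_eq_max_of_ne (ne_of_gt h), max_eq_left h.le, norm_one]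

/-- `‖(1 + 4y) − (1 + 4x)‖ = ¼‖y − x‖`. [folklore] -/
private theorem norm_one_add_four_mul_sub (x y : ℤ_[2]) :
    ‖((1 : ℚ_[2]) + 4 * (y : ℚ_[2])) - (1 + 4 * (x : ℚ_[2]))‖ = 4⁻¹ * ‖y - x‖ := by
  have e : ((1 : ℚ_[2]) + 4 * (y : ℚ_[2])) - (1 + 4 * (x : ℚ_[2])) = 4 * ((y - x : ℤ_[2]) : ℚ_[2]) := by
    push_cast
    ring
  rw [e, norm_mul, norm_four, PadicInt.padic_norm_e_of_padicInt]

/-- The Lipschitz estimate for `D(t) = (1+4t)^m − (1+4t)^{−e}` when `m + e = 2^M`: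
`‖D(y) − D(x)‖ ≤ 2^{−M}‖y − x‖` (`D = (1+4t)^{−e}((1+4t)^{2^M} − 1)`). [folklore] -/
private theorem norm_diff_sub_diff_le {m e M : ℕ} (hme : m + e = 2 ^ M) (x y : ℤ_[2]) :
    ‖(((1 : ℚ_[2]) + 4 * (y : ℚ_[2])) ^ m - ((1 : ℚ_[2]) + 4 * (y : ℚ_[2])) ^ (-(e : ℤ))) -
        (((1 : ℚ_[2]) + 4 * (x : ℚ_[2])) ^ m - ((1 : ℚ_[2]) + 4 * (x : ℚ_[2])) ^ (-(e : ℤ)))‖ ≤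
      (2⁻¹ : ℝ) ^ M * ‖y - x‖ := by
  set a : ℚ_[2] := (1 : ℚ_[2]) + 4 * (y : ℚ_[2]) with ha_def
  set b : ℚ_[2] := (1 : ℚ_[2]) + 4 * (x : ℚ_[2]) with hb_def
  have ha1 : ‖a‖ = 1 := norm_one_add_four_mul y
  have hb1 : ‖b‖ = 1 := norm_one_add_four_mul x
  have ha0 : a ≠ 0 := norm_pos_iff.mp (by rw [ha1]; exact one_pos)
  have hb0 : b ≠ 0 := norm_pos_iff.mp (by rw [hb1]; exact one_pos)
  have hyx1 : ‖y - x‖ ≤ 1 := PadicInt.norm_le_one _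
  have hab : ‖a - b‖ = 4⁻¹ * ‖y - x‖ := norm_one_add_four_mul_sub x y
  have hab' : ‖a - b‖ ≤ ‖y - x‖ := by
    rw [hab]
    exact mul_le_of_le_one_left (norm_nonneg _) (by norm_num)
  have hab2 : ‖a - b‖ ≤ 2⁻¹ := by
    rw [hab]
    calc 4⁻¹ * ‖y - x‖ ≤ 4⁻¹ * 1 := by gcongr
      _ ≤ 2⁻¹ := by norm_num
  have hb1' : ‖b - 1‖ ≤ 2⁻¹ := by
    rw [hb_def, add_sub_cancel_left, norm_mul, norm_four]
    calc 4⁻¹ * ‖(x : ℚ_[2])‖ ≤ 4⁻¹ * 1 := by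
          gcongr
          exact PadicInt.norm_le_one x
      _ ≤ 2⁻¹ := by norm_num
  -- factorisations `c^m = c^{2^M} c^{−e}`
  have hfac : ∀ c : ℚ_[2], c ≠ 0 → c ^ m = c ^ 2 ^ M * c ^ (-(e : ℤ)) := by
    intro c hc
    rw [zpow_neg, zpow_natCast, ← hme, pow_add, mul_assoc, mul_inv_cancel₀ (pow_ne_zero _ hc), mul_one]
  have hid : (a ^ m - a ^ (-(e : ℤ))) - (b ^ m - b ^ (-(e : ℤ))) =
      a ^ (-(e : ℤ)) * (a ^ 2 ^ M - b ^ 2 ^ M) + (a ^ (-(e : ℤ)) - b ^ (-(e : ℤ))) * (b ^ 2 ^ M - 1) := by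
    rw [hfac a ha0, hfac b hb0]
    ring
  rw [hid]
  have hae : ‖a ^ (-(e : ℤ))‖ = 1 := by rw [norm_zpow, ha1, one_zpow]
  refine (IsUltrametricDist.norm_add_le_max _ _).trans (max_le ?_ ?_)
  · rw [norm_mul, hae, one_mul]
    calc ‖a ^ 2 ^ M - b ^ 2 ^ M‖ ≤ (2⁻¹ : ℝ) ^ M * ‖a - b‖ :=
          norm_pow_two_pow_sub_le hb1.le hab2 M
      _ ≤ (2⁻¹ : ℝ) ^ M * ‖y - x‖ := by gcongr
  · rw [norm_mul]
    have h1 : ‖a ^ (-(e : ℤ)) - b ^ (-(e : ℤ))‖ ≤ ‖y - x‖ :=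
      (norm_zpow_neg_sub_zpow_neg_le ha1 hb1 e).trans hab'
    have h2 : ‖b ^ 2 ^ M - 1‖ ≤ (2⁻¹ : ℝ) ^ M := by
      have h := norm_pow_two_pow_sub_le (a := b) (b := 1) (by simp) (by simpa using hb1') M
      rw [one_pow] at h
      refine h.trans ?_
      calc (2⁻¹ : ℝ) ^ M * ‖b - 1‖ ≤ (2⁻¹ : ℝ) ^ M * 1 := by
            gcongr
            exact hb1'.trans (by norm_num)
        _ = (2⁻¹ : ℝ) ^ M := mul_one _
    calc ‖a ^ (-(e : ℤ)) - b ^ (-(e : ℤ))‖ * ‖b ^ 2 ^ M - 1‖ ≤ ‖y - x‖ * (2⁻¹ : ℝ) ^ M :=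
          mul_le_mul h1 h2 (norm_nonneg _) (norm_nonneg _)
      _ = (2⁻¹ : ℝ) ^ M * ‖y - x‖ := mul_comm _ _

/-! ## §2. The uniform estimate `‖S_r((1+4t)^m) − S_r((1+4t)^{−e})‖ ≤ 2^{1−M}` for `m + e = 2^M` -/

/-- **Uniform approximation of Riemann sums:** if `m + e = 2^M` then for every `r`,
`‖2^{−r} Σ_{n<2^r} (1+4n)^m − 2^{−r} Σ_{n<2^r} (1+4n)^{−e}‖ ≤ 2·2^{−M}` — Robert's
`|∫ f| ≤ p‖f‖₁` (V.5.1 Proposition 1 (a), the tree's `norm_volkenbornSum_le`) for the difference, whose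
value at `0` vanishes and whose difference quotients are `≤ 2^{−M}`; this is the `S¹`-convergence
`(1+4t)^{m_N} → (1+4t)^{1−j}` behind "the branches interpolating the values of the Riemann zeta function
at negative integers". [cite: Lai2025TwoAdicZeta, §2.2–§2.3 (Volkenborn integrals; interpolation)] -/
theorem norm_volkenbornSum_pow_sub_zpow_le {m e M : ℕ} (hme : m + e = 2 ^ M) (r : ℕ) :
    ‖volkenbornSum 2 (fun t : ℤ_[2] => ((1 : ℚ_[2]) + 4 * (t : ℚ_[2])) ^ m) r -
        volkenbornSum 2 (fun t : ℤ_[2] => ((1 : ℚ_[2]) + 4 * (t : ℚ_[2])) ^ (-(e : ℤ))) r‖ ≤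
      2 * (2⁻¹ : ℝ) ^ M := by
  rw [← volkenbornSum_sub]
  have h := norm_volkenbornSum_le (p := 2)
    (f := fun t : ℤ_[2] => ((1 : ℚ_[2]) + 4 * (t : ℚ_[2])) ^ m - ((1 : ℚ_[2]) + 4 * (t : ℚ_[2])) ^ (-(e : ℤ)))
    (M := (2⁻¹ : ℝ) ^ M) (by positivity) (fun x y => norm_diff_sub_diff_le hme x y) r
  refine h.trans (max_le ?_ ?_)
  · refine le_trans (le_of_eq ?_) (by positivity : (0 : ℝ) ≤ 2 * (2⁻¹ : ℝ) ^ M)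
    simp
  · norm_num

/-! ## §3. The interpolation: the tree's defining sequence of `ζ_2(j)` converges -/

/-- `m_N(2, j) + (j − 1) = 2^{N+j}`. [cite: Lai2025TwoAdicZeta, §2.3 (interpolation along `k ≡ s`, `k → s`)] -/
theorem interpIndex_two_add (j N : ℕ) (hj : 1 ≤ j) : interpIndex 2 j N + (j - 1) = 2 ^ (N + j) := by
  have h := interpIndex_add (p := 2) le_rfl j N
  norm_num at h
  omega

/-- For odd `j`, every `m_N(2, j)` is even. [cite: Lai2025TwoAdicZeta, §2.3 (interpolation)] -/
theorem even_interpIndex_two {j : ℕ} (hj : Odd j) (N : ℕ) : Even (interpIndex 2 j N) := by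
  have h := interpIndex_two_add j N hj.pos
  have h2 : Even (2 ^ (N + j)) := (Nat.even_pow' (by have := hj.pos; omega)).mpr even_two
  rcases Nat.even_or_odd (interpIndex 2 j N) with hm | hm
  · exact hm
  · exfalso
    obtain ⟨k, hk⟩ := hj
    have hodd : Odd (interpIndex 2 j N + (j - 1)) := by
      rw [show j - 1 = 2 * k by omega]
      exact hm.add_even (even_two_mul k)
    rw [h] at hodd
    exact (Nat.not_even_iff_odd.mpr hodd) h2

/-- The tree's `ζ_2(1 − m)·`-sequence in closed form: `((zetaNeg 2 m : ℚ) : ℚ_2) = −(1 − 2^{m−1}) B_m / m`.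
[cite: Lai2025TwoAdicZeta, §2.3 (values at negative integers)] -/
theorem cast_zetaNeg_two (m : ℕ) :
    ((zetaNeg 2 m : ℚ) : ℚ_[2]) = -((1 - (2 : ℚ_[2]) ^ (m - 1)) * ((bernoulli m : ℚ) : ℚ_[2])) / (m : ℚ_[2]) := by
  simp only [zetaNeg]
  push_cast
  ring

/-- For even `m ≥ 2` with `m + e = 2^M`, and `W` the limit of the Riemann sums of `(1+4t)^{−e}`:
`‖2(1 − 2^{m−1})B_m − W‖ ≤ 2·2^{−M}`. [cite: Lai2025TwoAdicZeta, §2.3 (interpolation)] -/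
theorem norm_bernoulli_factor_sub_le {m e M : ℕ} (hm : Even m) (hm0 : m ≠ 0) (hme : m + e = 2 ^ M)
    {W : ℚ_[2]}
    (hW : Tendsto (volkenbornSum 2 (fun t : ℤ_[2] => ((1 : ℚ_[2]) + 4 * (t : ℚ_[2])) ^ (-(e : ℤ))))
      atTop (𝓝 W)) :
    ‖2 * (1 - (2 : ℚ_[2]) ^ (m - 1)) * ((bernoulli m : ℚ) : ℚ_[2]) - W‖ ≤ 2 * (2⁻¹ : ℝ) ^ M := by
  have hA := tendsto_volkenbornSum_one_add_four_mul_pow hm hm0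
  have hlim := (hA.sub hW).norm
  exact le_of_tendsto' hlim fun r => norm_volkenbornSum_pow_sub_zpow_le hme r

/-- **The interpolation property for the branch `ω^{1−j}`, `p = 2`:** for odd `j ≥ 3`, if the
Riemann sums of `(1+4t)^{1−j}` tend to `W` (they do: `HurwitzVolkenbornProofs`), then the tree's
defining sequence `N ↦ ζ_2(1 − m_N)(1 − 2^{m_N − 1}) = −(1 − 2^{m_N−1}) B_{m_N}/m_N`,
`m_N = 2^{N+j} + 1 − j`, CONVERGES in `ℚ_2` to `W / (2(j−1))` ("`ζ_p(s) = lim_{k → s} ζ(k)` … the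
branches interpolating the values of the Riemann zeta function at negative integers").
[cite: Lai2025TwoAdicZeta, §1 (p. 2) and §2.3 (p. 6)] -/
theorem tendsto_cast_zetaNeg_interpIndex_two {j : ℕ} (hj : Odd j) (hj3 : 3 ≤ j) {W : ℚ_[2]}
    (hW : Tendsto (volkenbornSum 2 (fun t : ℤ_[2] => ((1 : ℚ_[2]) + 4 * (t : ℚ_[2])) ^ (-((j - 1 : ℕ) : ℤ))))
      atTop (𝓝 W)) :
    Tendsto (fun N : ℕ => ((zetaNeg 2 (interpIndex 2 j N) : ℚ) : ℚ_[2])) atTop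
      (𝓝 (W / (2 * ((j : ℚ_[2]) - 1)))) := by
  -- `A_N := 2(1 − 2^{m_N−1}) B_{m_N} → W`
  set A : ℕ → ℚ_[2] := fun N => 2 * (1 - (2 : ℚ_[2]) ^ (interpIndex 2 j N - 1)) *
    ((bernoulli (interpIndex 2 j N) : ℚ) : ℚ_[2]) with hA
  have hAW : Tendsto A atTop (𝓝 W) := by
    rw [tendsto_iff_norm_sub_tendsto_zero]
    have hbound : ∀ N, ‖A N - W‖ ≤ 2 * (2⁻¹ : ℝ) ^ (N + j) := fun N =>
      norm_bernoulli_factor_sub_le (even_interpIndex_two hj N)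
        (by have := two_le_interpIndex (p := 2) le_rfl j N; omega)
        (interpIndex_two_add j N (by omega)) hW
    refine squeeze_zero (fun N => norm_nonneg _) hbound ?_
    have h0 : Tendsto (fun N : ℕ => 2 * (2⁻¹ : ℝ) ^ (N + j)) atTop (𝓝 (2 * 0)) :=
      ((tendsto_pow_atTop_nhds_zero_of_lt_one (by norm_num) (by norm_num)).comp
        (tendsto_add_atTop_nat j)).const_mul 2
    rwa [mul_zero] at h0
  -- `m_N → −(j−1)` in `ℚ_2`
  have hcast : ∀ N, ((interpIndex 2 j N : ℕ) : ℚ_[2]) = (2 : ℚ_[2]) ^ (N + j) - ((j - 1 : ℕ) : ℚ_[2]) := by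
    intro N
    have h := interpIndex_two_add j N (by omega)
    rw [eq_sub_iff_add_eq]
    exact_mod_cast h
  have hm : Tendsto (fun N : ℕ => ((interpIndex 2 j N : ℕ) : ℚ_[2])) atTop
      (𝓝 (0 - ((j - 1 : ℕ) : ℚ_[2]))) := by
    have h2 : Tendsto (fun N : ℕ => (2 : ℚ_[2]) ^ (N + j)) atTop (𝓝 0) :=
      (tendsto_pow_atTop_nhds_zero_of_norm_lt_one (by rw [norm_two]; norm_num)).comp
        (tendsto_add_atTop_nat j)
    exact (h2.sub_const _).congr fun N => (hcast N).symm
  rw [zero_sub] at hm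
  -- the sequence is `−A_N / (2 m_N)`
  have hden : (2 : ℚ_[2]) * (-((j - 1 : ℕ) : ℚ_[2])) ≠ 0 := by
    refine mul_ne_zero two_ne_zero (neg_ne_zero.mpr ?_)
    exact_mod_cast (show (j - 1 : ℕ) ≠ 0 by omega)
  have hlim := (hAW.neg).div (hm.const_mul (2 : ℚ_[2])) hden
  have hval : -W / (2 * -((j - 1 : ℕ) : ℚ_[2])) = W / (2 * ((j : ℚ_[2]) - 1)) := by
    rw [Nat.cast_sub (by omega), Nat.cast_one, mul_neg, neg_div_neg_eq]
  rw [hval] at hlim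
  have key : ∀ N, ((zetaNeg 2 (interpIndex 2 j N) : ℚ) : ℚ_[2]) =
      -A N / (2 * ((interpIndex 2 j N : ℕ) : ℚ_[2])) := by
    intro N
    have hm0 : ((interpIndex 2 j N : ℕ) : ℚ_[2]) ≠ 0 := by
      exact_mod_cast (show interpIndex 2 j N ≠ 0 by
        have := two_le_interpIndex (p := 2) le_rfl j N; omega)
    rw [cast_zetaNeg_two]
    simp only [hA]
    field_simp
  refine hlim.congr fun N => ?_
  rw [Pi.div_apply, key]

/-- Hence **`ζ_2(j) = W/(2(j−1))`** for the tree's `padicZetaValue` (a `limUnder` of a sequence now PROVED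
convergent). [cite: Lai2025TwoAdicZeta, §2.3 (p. 6)] -/
theorem padicZetaValue_two_eq {j : ℕ} (hj : Odd j) (hj3 : 3 ≤ j) {W : ℚ_[2]}
    (hW : Tendsto (volkenbornSum 2 (fun t : ℤ_[2] => ((1 : ℚ_[2]) + 4 * (t : ℚ_[2])) ^ (-((j - 1 : ℕ) : ℤ))))
      atTop (𝓝 W)) :
    padicZetaValue 2 j = W / (2 * ((j : ℚ_[2]) - 1)) := by
  rw [padicZetaValue_def]
  exact (tendsto_cast_zetaNeg_interpIndex_two hj hj3 hW).limUnder_eq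

/-! ## §4. `ω(¼) = ¼` and `ζ_2(j, ¼)` -/

/-- `‖¼‖_2 = 4 = q_2`. [cite: Lai2025TwoAdicZeta, §2.3 (the hypothesis `|x|_p ≥ q_p` at `x = ¼`)] -/
theorem norm_inv_four : ‖(4 : ℚ_[2])⁻¹‖ = 4 := by
  rw [norm_inv, norm_four, inv_inv]

/-- `q_2 ≤ ‖¼‖_2`. [cite: Lai2025TwoAdicZeta, §2.3 (`|x|_p ≥ q_p` at `x = ¼`)] -/
theorem qp_two_le_norm_inv_four : ((qp 2 : ℕ) : ℝ) ≤ ‖(4 : ℚ_[2])⁻¹‖ := by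
  rw [norm_inv_four, qp, if_pos rfl]
  norm_num

/-- **`ω(¼) = ¼`** (valuation `−2`, unit part `1`). [cite: Lai2025TwoAdicZeta, §2.3 (definition of `ω` on `ℚ_p^×` and of `⟨x⟩`)] -/
theorem teichmuller_inv_four : teichmuller 2 ((4 : ℚ_[2])⁻¹) = (4 : ℚ_[2])⁻¹ := by
  have hv : ((4 : ℚ_[2])⁻¹).valuation = -2 := by
    rw [Padic.valuation_inv, show (4 : ℚ_[2]) = ((2 ^ 2 : ℕ) : ℚ_[2]) by norm_num,
      Padic.valuation_natCast, padicValNat.prime_pow]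
    norm_num
  have h22 : ((2 : ℕ) : ℚ_[2]) ^ (2 : ℤ) = 4 := by norm_num
  unfold teichmuller
  rw [hv, neg_neg, h22, inv_mul_cancel₀ four_ne_zero', teichmullerUnit_two]
  simp only [sub_self, norm_zero]
  rw [if_pos (by norm_num), mul_one, zpow_neg, h22]

/-- `⟨¼ + m⟩^{1−j} = (1 + 4m)^{1−j}` for `m ∈ ℕ`. [cite: Lai2025TwoAdicZeta, §2.3 (Lemma 2.6, "∫ dt/(t+¼)^j = j4^j ζ_2(j+1,¼)")] -/
theorem angle_inv_four_add_natCast_zpow (m : ℕ) (n : ℤ) :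
    angle 2 ((4 : ℚ_[2])⁻¹ + m) ^ n = ((1 : ℚ_[2]) + 4 * (m : ℚ_[2])) ^ n := by
  rw [angle_add_natCast qp_two_le_norm_inv_four m, teichmuller_inv_four, div_inv_eq_mul]
  congr 1
  rw [add_mul, inv_mul_cancel₀ four_ne_zero']
  ring

/-- **`ζ_2(j, ¼) = W/(j − 1)`**, `W = ∫_{ℤ_2} (1+4t)^{1−j} dt` the limit of the typed Riemann sums.
[cite: Lai2025TwoAdicZeta, §2.3 (definition of `ζ_p(s, x)`; Lemma 2.6 at `x = ¼`)] -/
theorem padicHurwitzZeta_two_inv_four_eq {j : ℕ} (hj1 : 1 ≤ j) {W : ℚ_[2]}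
    (hW : Tendsto (volkenbornSum 2 (fun t : ℤ_[2] => ((1 : ℚ_[2]) + 4 * (t : ℚ_[2])) ^ (-((j - 1 : ℕ) : ℤ))))
      atTop (𝓝 W)) :
    padicHurwitzZeta 2 j ((4 : ℚ_[2])⁻¹) = (1 / ((j : ℚ_[2]) - 1)) * W := by
  have hexp : (1 - (j : ℤ)) = -((j - 1 : ℕ) : ℤ) := by omega
  have hG : (fun r : ℕ => ((2 : ℕ) : ℚ_[2]) ^ (-(r : ℤ)) *
      ∑ m ∈ Finset.range (2 ^ r), angle 2 ((4 : ℚ_[2])⁻¹ + m) ^ (1 - (j : ℤ))) =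
      volkenbornSum 2 (fun t : ℤ_[2] => ((1 : ℚ_[2]) + 4 * (t : ℚ_[2])) ^ (-((j - 1 : ℕ) : ℤ))) := by
    funext r
    rw [volkenbornSum_def, smul_eq_mul, ← zpow_natCast, ← zpow_neg]
    congr 1
    refine sum_congr rfl fun m _ => ?_
    rw [angle_inv_four_add_natCast_zpow, hexp, PadicInt.coe_natCast]
  rw [padicHurwitzZeta_def, hG, hW.limUnder_eq]

/-! ## §5. Lemma 2.7 (`p = 2`) -/

/-- **Lai 2025, Lemma 2.7 (the case `p = 2`), PROVED** (discharge of `lai2025TwoAdic_lemma27_two`): for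
every odd integer `j ≥ 3`, `ζ_2(j) = ½ ζ_2(j, ¼)` — with the TREE's definitions: the interpolation limit
`padicZetaValue 2 j` (Basic.lean) equals one half of the Volkenborn-form Hurwitz value
`padicHurwitzZeta 2 j ¼` (Hurwitz.lean).  Both sides equal `W/(2(j−1))`,
`W = ∫_{ℤ_2} (1+4t)^{1−j} dt`. [cite: Lai2025TwoAdicZeta, Lemma 2.7 (§2.3)] -/
theorem lai2025TwoAdic_lemma27_two_holds : lai2025TwoAdic_lemma27_two := by
  intro j hj hj3
  -- the common limit `W`
  obtain ⟨k, hk⟩ : ∃ k : ℕ, j = k + 2 := ⟨j - 2, by omega⟩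
  have hx1 : 1 < ‖(4 : ℚ_[2])⁻¹‖ := by rw [norm_inv_four]; norm_num
  obtain ⟨V, hV⟩ : ∃ V : ℚ_[2], Tendsto (fun r : ℕ => ((2 : ℕ) : ℚ_[2]) ^ (-(r : ℤ)) *
      ∑ m ∈ range (2 ^ r), ((4 : ℚ_[2])⁻¹ + (m : ℚ_[2])) ^ (-((k : ℤ) + 1))) atTop (𝓝 V) :=
    ⟨_, tendsto_riemannSum_zpow_neg (p := 2) hx1 k⟩
  have hexp : (-((j - 1 : ℕ) : ℤ)) = -((k : ℤ) + 1) := by omega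
  have hW : Tendsto (volkenbornSum 2 (fun t : ℤ_[2] => ((1 : ℚ_[2]) + 4 * (t : ℚ_[2])) ^ (-((j - 1 : ℕ) : ℤ))))
      atTop (𝓝 ((4 : ℚ_[2]) ^ (-((k : ℤ) + 1)) * V)) := by
    refine (hV.const_mul ((4 : ℚ_[2]) ^ (-((k : ℤ) + 1)))).congr fun r => ?_
    rw [volkenbornSum_def, smul_eq_mul, ← zpow_natCast, ← zpow_neg, mul_left_comm]
    congr 1
    rw [mul_sum]
    refine sum_congr rfl fun m _ => ?_
    rw [PadicInt.coe_natCast, hexp, ← mul_zpow]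
    congr 1
    rw [mul_add, mul_inv_cancel₀ four_ne_zero']
  rw [padicZetaValue_two_eq hj hj3 hW, padicHurwitzZeta_two_inv_four_eq (by omega) hW]
  have hj1 : ((j : ℚ_[2]) - 1) ≠ 0 := by
    rw [hk]
    push_cast
    rw [show (k : ℚ_[2]) + 2 - 1 = ((k + 1 : ℕ) : ℚ_[2]) by push_cast; ring]
    exact_mod_cast Nat.succ_ne_zero k
  field_simp

end Literature.NumberTheory.Irrationality.PAdicZetaValues
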